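import Mathlib
import Summits.Ventures.PercRepro2.Defs
import Summits.Ventures.PercRepro2.Graph
import Summits.Ventures.PercRepro2.OneColourSwitch

/-!
# The one-colour-separated switch on a typed fibre (blind cell PercRepro2, p3 g15, 2026-08-27;
`proofs/P3-CPNC.md` §9a)

A spectator fibre of the typed calculus (`TriDisagreementPinned.typedCount`) colours only the FREE
edges `F` complementarily; every edge off `F` is open in both colours (a «double» edge) or closed in
both (an «absent» one), as the base configuration `z` says.  Here the `W`-colour class of `ω` is
`flipOn F ω` (flip the free edges only), the configurations range over those agreeing with `z` off
`F`, and the switch flips the free edges touching `C_Y(r)`.  The theorem of `OneColourSwitch`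
(`card_leftSet_le_card_rightSet`) and the pendant class theorem hold on every fibre with the same
proof: a double edge never leaves a `Y`-cluster, so the `W`-cluster of `r` in the image is again
exactly `C_Y(r)` (`clusterF_flipOn_switchF`).  Own work; standard axioms.
-/

namespace Summit.Ventures.PercRepro2

namespace OneColourSwitch

open Finset Classical

variable {V : Type*} {E : Type*}
variable (ends : E → Sym2 V)

/-- The `W`-colour class on a fibre: flip the free edges `F`, keep the rest. -/
noncomputable def flipOn (F : Set E) (ω : Config E) : Config E :=
  fun e => if e ∈ F then !ω e else ω e

/-- Flip the free edges touching `S`. -/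
noncomputable def flipTouchF (F : Set E) (S : Set V) (ω : Config E) : Config E :=
  fun e => if e ∈ F ∧ e ∈ touches ends S then !ω e else ω e

/-- The fibre switch: flip the free edges touching the `Y`-cluster of `r`. -/
noncomputable def switchF (F : Set E) (r : V) (ω : Config E) : Config E :=
  flipTouchF ends F (cluster ends ω r) ω

/-- The configurations of the fibre: those agreeing with `z` off `F`. -/
def fibre (F : Set E) (z : Config E) : Set (Config E) := {ω | ∀ e, e ∉ F → ω e = z e}

/-- The left set on the fibre: `p ~_Y q`, `r ~_Y s`, `Y`-separated. -/
def leftSetF (F : Set E) (z : Config E) (p q r s : V) : Set (Config E) :=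
  {ω | ω ∈ fibre F z ∧ Conn ends ω p q ∧ Conn ends ω r s ∧ sepY ends p q r s ω}

/-- The right set on the fibre: `p ~_Y q`, `r ~_W s`, `W`-separated (`W = flipOn F ω`). -/
def rightSetF (F : Set E) (z : Config E) (p q r s : V) : Set (Config E) :=
  {ω | ω ∈ fibre F z ∧ Conn ends ω p q ∧ Conn ends (flipOn F ω) r s ∧
    sepY ends p q r s (flipOn F ω)}

/-- The two-colour separation on the fibre. -/
def sep2F (F : Set E) (p q r s : V) (ω : Config E) : Prop :=
  sepY ends p q r s ω ∧ sepY ends p q r s (flipOn F ω)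

/-- The left set of `m9′` on the fibre. -/
def m9LeftF (F : Set E) (z : Config E) (p q r s : V) : Set (Config E) :=
  {ω | ω ∈ fibre F z ∧ sep2F ends F p q r s ω ∧ Conn ends ω p q ∧ Conn ends ω r s}

/-- The right set of `m9′` on the fibre. -/
def m9RightF (F : Set E) (z : Config E) (p q r s : V) : Set (Config E) :=
  {ω | ω ∈ fibre F z ∧ sep2F ends F p q r s ω ∧ Conn ends ω p q ∧ Conn ends (flipOn F ω) r s}

section Lemmas

variable {ends} {F : Set E}

omit ends in
/-- `flipOn` on a free edge. -/
lemma flipOn_of_mem {ω : Config E} {e : E} (h : e ∈ F) : flipOn F ω e = !ω e := by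
  simp [flipOn, h]

omit ends in
/-- `flipOn` off the free edges. -/
lemma flipOn_of_notMem {ω : Config E} {e : E} (h : e ∉ F) : flipOn F ω e = ω e := by
  simp [flipOn, h]

/-- `flipTouchF` on a free edge touching `S`. -/
lemma flipTouchF_of_mem {S : Set V} {ω : Config E} {e : E} (hF : e ∈ F)
    (h : e ∈ touches ends S) : flipTouchF ends F S ω e = !ω e := by
  simp [flipTouchF, hF, h]

/-- `flipTouchF` elsewhere. -/
lemma flipTouchF_of_not {S : Set V} {ω : Config E} {e : E} (h : ¬ (e ∈ F ∧ e ∈ touches ends S)) :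
    flipTouchF ends F S ω e = ω e := by
  simp [flipTouchF, h]

/-- `flipTouchF F S` is an involution. -/
lemma flipTouchF_flipTouchF (S : Set V) (ω : Config E) :
    flipTouchF ends F S (flipTouchF ends F S ω) = ω := by
  funext e
  by_cases h : e ∈ F ∧ e ∈ touches ends S
  · rw [flipTouchF_of_mem h.1 h.2, flipTouchF_of_mem h.1 h.2, Bool.not_not]
  · rw [flipTouchF_of_not h, flipTouchF_of_not h]

/-- The switch stays on the fibre. -/
lemma switchF_mem_fibre {z : Config E} {r : V} {ω : Config E} (hω : ω ∈ fibre F z) :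
    switchF ends F r ω ∈ fibre F z := by
  intro e he
  rw [switchF, flipTouchF_of_not (fun h => he h.1)]
  exact hω e he

/-- The `W`-class of the switch agrees with `ω` on the edges touching the cluster of `r`
(free edges are flipped twice, fixed edges never). -/
lemma flipOn_switchF_of_mem {r : V} {ω : Config E} {e : E}
    (h : e ∈ touches ends (cluster ends ω r)) : flipOn F (switchF ends F r ω) e = ω e := by
  by_cases hF : e ∈ F
  · rw [flipOn_of_mem hF, switchF, flipTouchF_of_mem hF h, Bool.not_not]
  · rw [flipOn_of_notMem hF, switchF, flipTouchF_of_not (fun h' => hF h'.1)]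

/-- The switch agrees with `ω` off the edges touching the cluster of `r`. -/
lemma switchF_of_notMem {r : V} {ω : Config E} {e : E}
    (h : e ∉ touches ends (cluster ends ω r)) : switchF ends F r ω e = ω e :=
  flipTouchF_of_not (fun h' => h h'.2)

/-- `p ~ q` survives the switch when `p` is outside the cluster of `r`. -/
lemma conn_switchF_of_notMem {r p q : V} {ω : Config E} (hp : p ∉ cluster ends ω r)
    (h : Conn ends ω p q) : Conn ends (switchF ends F r ω) p q := by
  have key : q ∈ {x | x ∉ cluster ends ω r ∧ Conn ends (switchF ends F r ω) p x} := by
    refine mem_of_conn_of_closed (ends := ends) (ω := ω) ?_ ⟨hp, conn_refl _ _ _⟩ h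
    rintro x ⟨hxK, hxc⟩ y hxy
    obtain ⟨_, e, he, hends⟩ := openGraph_adj.1 hxy
    have hyK : y ∉ cluster ends ω r := fun hy =>
      hxK (mem_cluster_of_openEdge he (by rw [hends, Sym2.eq_swap]) hy)
    have hnt : e ∉ touches ends (cluster ends ω r) := by
      rintro ⟨x', hx', y', hends'⟩
      rw [hends, Sym2.eq_iff] at hends'
      rcases hends' with ⟨rfl, _⟩ | ⟨_, rfl⟩
      · exact hxK hx'
      · exact hyK hx'
    have he' : switchF ends F r ω e = true := by rw [switchF_of_notMem hnt]; exact he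
    exact ⟨hyK, conn_trans hxc (conn_of_openAdj ⟨e, he', hends⟩)⟩
  exact key.2

/-- The cluster is `W`-connected after the switch. -/
lemma conn_flipOn_switchF_of_mem {r u : V} {ω : Config E} (hu : u ∈ cluster ends ω r) :
    Conn ends (flipOn F (switchF ends F r ω)) r u := by
  have key : u ∈ {x | x ∈ cluster ends ω r ∧ Conn ends (flipOn F (switchF ends F r ω)) r x} := by
    refine mem_of_conn_of_closed (ends := ends) (ω := ω) ?_
      ⟨mem_cluster_self ends ω r, conn_refl _ _ _⟩ hu
    rintro x ⟨hxK, hxc⟩ y hxy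
    obtain ⟨_, e, he, hends⟩ := openGraph_adj.1 hxy
    have ht : e ∈ touches ends (cluster ends ω r) := mem_touches_of_ends hends (Or.inl hxK)
    have he' : flipOn F (switchF ends F r ω) e = true := by rw [flipOn_switchF_of_mem ht]; exact he
    exact ⟨mem_cluster_of_openEdge he hends hxK, conn_trans hxc (conn_of_openAdj ⟨e, he', hends⟩)⟩
  exact key.2

/-- The `W`-cluster of `r` after the switch stays inside `C_Y(r)`. -/
lemma mem_cluster_of_conn_flipOn_switchF {r u : V} {ω : Config E}
    (h : Conn ends (flipOn F (switchF ends F r ω)) r u) : u ∈ cluster ends ω r := by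
  refine mem_of_conn_of_closed (ends := ends) (ω := flipOn F (switchF ends F r ω)) ?_
    (mem_cluster_self ends ω r) h
  intro x hxK y hxy
  obtain ⟨_, e, he, hends⟩ := openGraph_adj.1 hxy
  have ht : e ∈ touches ends (cluster ends ω r) := mem_touches_of_ends hends (Or.inl hxK)
  have he' : ω e = true := by rw [← flipOn_switchF_of_mem (F := F) ht]; exact he
  exact mem_cluster_of_openEdge he' hends hxK

/-- The `W`-cluster of `r` after the switch is exactly the old `Y`-cluster. -/
lemma clusterF_flipOn_switchF (r : V) (ω : Config E) :
    cluster ends (flipOn F (switchF ends F r ω)) r = cluster ends ω r :=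
  Set.Subset.antisymm (fun _ hu => mem_cluster_of_conn_flipOn_switchF hu)
    (fun _ hu => conn_flipOn_switchF_of_mem hu)

/-- The switch maps the left set of the fibre into its right set. -/
lemma switchF_mem_rightSetF {z : Config E} {p q r s : V} {ω : Config E}
    (hω : ω ∈ leftSetF ends F z p q r s) : switchF ends F r ω ∈ rightSetF ends F z p q r s := by
  obtain ⟨hz, hpq, hrs, hpr, hps, hqr, hqs⟩ := hω
  have hpK : p ∉ cluster ends ω r := fun h => hpr (conn_symm h)
  have hqK : q ∉ cluster ends ω r := fun h => hqr (conn_symm h)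
  have hrs' : Conn ends (flipOn F (switchF ends F r ω)) r s := conn_flipOn_switchF_of_mem hrs
  refine ⟨switchF_mem_fibre hz, conn_switchF_of_notMem hpK hpq, hrs', ?_, ?_, ?_, ?_⟩
  · exact fun h => hpK (mem_cluster_of_conn_flipOn_switchF (conn_symm h))
  · exact fun h => hpK (mem_cluster_of_conn_flipOn_switchF (conn_trans hrs' (conn_symm h)))
  · exact fun h => hqK (mem_cluster_of_conn_flipOn_switchF (conn_symm h))
  · exact fun h => hqK (mem_cluster_of_conn_flipOn_switchF (conn_trans hrs' (conn_symm h)))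

/-- The fibre switch is injective. -/
lemma switchF_injective (r : V) : Function.Injective (switchF ends F r) := by
  intro ω ω' h
  have hK : cluster ends ω r = cluster ends ω' r := by
    rw [← clusterF_flipOn_switchF (ends := ends) (F := F) r ω,
      ← clusterF_flipOn_switchF (ends := ends) (F := F) r ω', h]
  have h1 : ω = flipTouchF ends F (cluster ends ω r) (switchF ends F r ω) :=
    (flipTouchF_flipTouchF _ ω).symm
  have h2 : ω' = flipTouchF ends F (cluster ends ω' r) (switchF ends F r ω') :=
    (flipTouchF_flipTouchF _ ω').symm
  rw [h1, h2, hK, h]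

end Lemmas

section Count

variable [Fintype E] [DecidableEq E]

/-- **The one-colour-separated switch on a typed fibre**: with the free edges `F` coloured
complementarily and the rest fixed by `z` in both colours,
`#{p ~_Y q, r ~_Y s, {p,q} ≁_Y {r,s}} ≤ #{p ~_Y q, r ~_W s, {p,q} ≁_W {r,s}}`. -/
theorem card_leftSetF_le_card_rightSetF (F : Set E) (z : Config E) (p q r s : V) :
    (univ.filter (fun ω : Config E => ω ∈ leftSetF ends F z p q r s)).card ≤
      (univ.filter (fun ω : Config E => ω ∈ rightSetF ends F z p q r s)).card := by
  apply Finset.card_le_card_of_injOn (switchF ends F r)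
  · intro ω hω
    simp only [coe_filter, mem_univ, true_and, Set.mem_setOf_eq] at hω ⊢
    exact switchF_mem_rightSetF hω
  · exact (switchF_injective (ends := ends) (F := F) r).injOn

end Count

/-! ## `m9′` for pendant `r, s` on a fibre -/

section PendantF

variable {ends} {F : Set E}

/-- A pendant mark whose single edge is open and FREE has no open edge after the fibre switch. -/
lemma switchF_no_openEdge_of_pendant {r : V} {e₁ : E} {ω : Config E} (hp : Pendant ends r e₁)
    (hF : e₁ ∈ F) (hrs : ω e₁ = true) : ∀ e, r ∈ ends e → switchF ends F r ω e = false := by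
  intro e he
  have : e = e₁ := hp.1 e he
  subst this
  have ht : e ∈ touches ends (cluster ends ω r) := by
    obtain ⟨v, _, hv⟩ := hp.2
    exact mem_touches_of_ends hv (Or.inl (mem_cluster_self ends ω r))
  rw [switchF, flipTouchF_of_mem hF ht, hrs]
  rfl

/-- The same for the second pendant mark `s ∈ C_Y(r)`. -/
lemma switchF_no_openEdge_of_pendant' {r s : V} {e₂ : E} {ω : Config E} (hp : Pendant ends s e₂)
    (hF : e₂ ∈ F) (hs : s ∈ cluster ends ω r) (hsr : s ≠ r) :
    ∀ e, s ∈ ends e → switchF ends F r ω e = false := by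
  intro e he
  have : e = e₂ := hp.1 e he
  subst this
  have hopen : ω e = true := open_of_conn_of_pendant hp hsr.symm (conn_symm hs)
  have ht : e ∈ touches ends (cluster ends ω r) := by
    obtain ⟨v, _, hv⟩ := hp.2
    exact mem_touches_of_ends hv (Or.inl hs)
  rw [switchF, flipTouchF_of_mem hF ht, hopen]
  rfl

/-- The fibre switch maps the `m9′` left set into the right set when `r, s` are pendant with FREE
edges. -/
lemma switchF_mem_m9RightF_of_pendant {z : Config E} {p q r s : V} {e₁ e₂ : E}
    (hr : Pendant ends r e₁) (hs : Pendant ends s e₂) (hF₁ : e₁ ∈ F) (hF₂ : e₂ ∈ F)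
    (hpr : p ≠ r) (hps : p ≠ s) (hqr : q ≠ r) (hqs : q ≠ s) (hrs : r ≠ s) {ω : Config E}
    (hω : ω ∈ m9LeftF ends F z p q r s) : switchF ends F r ω ∈ m9RightF ends F z p q r s := by
  obtain ⟨hz, ⟨hY, _⟩, hpq, hrsc⟩ := hω
  have hleft : ω ∈ leftSetF ends F z p q r s := ⟨hz, hpq, hrsc, hY⟩
  obtain ⟨hz', hpq', hrs', hW⟩ := switchF_mem_rightSetF hleft
  have hr0 : ∀ e, r ∈ ends e → switchF ends F r ω e = false :=
    switchF_no_openEdge_of_pendant hr hF₁ (open_of_conn_of_pendant hr hrs.symm hrsc)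
  have hs0 : ∀ e, s ∈ ends e → switchF ends F r ω e = false :=
    switchF_no_openEdge_of_pendant' hs hF₂ hrsc hrs.symm
  refine ⟨hz', ⟨⟨?_, ?_, ?_, ?_⟩, hW⟩, hpq', hrs'⟩
  · exact fun h => hpr (eq_of_conn_of_no_openEdge hr0 h)
  · exact fun h => hps (eq_of_conn_of_no_openEdge hs0 h)
  · exact fun h => hqr (eq_of_conn_of_no_openEdge hr0 h)
  · exact fun h => hqs (eq_of_conn_of_no_openEdge hs0 h)

end PendantF

section CountF

variable [Fintype E] [DecidableEq E]

/-- **`m9′` for pendant `r, s` on every typed fibre** (free edges `F`, the rest fixed by `z` in both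
colours; the pendant edges free). -/
theorem card_m9LeftF_le_card_m9RightF_of_pendant (F : Set E) (z : Config E) {p q r s : V}
    {e₁ e₂ : E} (hr : Pendant ends r e₁) (hs : Pendant ends s e₂) (hF₁ : e₁ ∈ F) (hF₂ : e₂ ∈ F)
    (hpr : p ≠ r) (hps : p ≠ s) (hqr : q ≠ r) (hqs : q ≠ s) (hrs : r ≠ s) :
    (univ.filter (fun ω : Config E => ω ∈ m9LeftF ends F z p q r s)).card ≤
      (univ.filter (fun ω : Config E => ω ∈ m9RightF ends F z p q r s)).card := by
  apply Finset.card_le_card_of_injOn (switchF ends F r)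
  · intro ω hω
    simp only [coe_filter, mem_univ, true_and, Set.mem_setOf_eq] at hω ⊢
    exact switchF_mem_m9RightF_of_pendant hr hs hF₁ hF₂ hpr hps hqr hqs hrs hω
  · exact (switchF_injective (ends := ends) (F := F) r).injOn

end CountF

end OneColourSwitch

end Summit.Ventures.PercRepro2
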